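import Literature.AlgebraicGeometry.Resolution.RelativeCurveValuativeInputCharP
import Literature.AlgebraicGeometry.Resolution.RelativeCurveConstantsCharZero
import HarnessLib

/-!
# Deep split discs at a finite purely inseparable level (Temkin 2013, Thm. 3.2.6, Step 2)

Topic: `Literature/AlgebraicGeometry/Resolution` (valued function fields). M. Temkin, *Inseparable
local uniformization*, J. Algebra 373 (2013) 65–119 = arXiv:0804.1554v3, §3.1–3.2. Temkin's
uniformization of terminal points of curves over a NON-perfect ground field `k` of height one
(Thm. 3.2.6) produces an `m`-split disc neighbourhood only "after a preliminary purely inseparable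
extension `l/k` of the ground field" (p. 5; proof of Thm. 3.3.1, Step 2: "we can choose `l̄` of the
form `l̂` for a finite purely inseparable extension `l/k`"). This file proves the finite-level,
henselian rendering of the part of that statement which the algebraic proof of Thm. 3.3.1 in the
tree consumes — ARBITRARILY DEEP rational discs around a transcendental element, avoiding any given
finite set of algebraic points, with centre and radius separable-algebraic over a finite purely
inseparable level `k(S)` and lying in the henselization of `K₁·k(S)`:

* `exists_mem_valuation_sub_lt_of_split_of_perfect` — over a perfect henselian ground field `C` of
  rank one, algebraically closed in the henselian `E ⊇ C` with `(E|C, V)` immediate: for `T ∈ E`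
  transcendental over `C` and `θ` algebraic over `C` some `c ∈ C` is STRICTLY closer to `T` than
  `θ` (Temkin's Cor. 3.1.10 "`K` is `k`-split", tree: `valuation_le_sub_of_forall_isAlgebraic_mem_of_perfect`,
  `forall_exists_valuation_sub_le_of_split`, sharpened by Knaf–Kuhlmann's Lemma 2.5
  `exists_valuation_sub_lt`: the values `|T − c|` have no minimum) — PROVED;
* `exists_deep_disc_of_split_of_perfect` — same setting, finitely many algebraic `θ`: a centre
  `a ∈ C` and a radius `d ∈ C` with `|T − a| = |d| < |T − θ|` for all of them — PROVED;
* `exists_level_deep_disc` — **the finite level**: for `k ≤ K₁ ≤ (Ω, V)` of rank one in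
  characteristic `p`, `|K₁^×|/|k^×|` torsion and `K̃₁/k̃` algebraic, `T ∈ K₁` transcendental over
  `k` and finitely many `θ` algebraic over `k`, there are a finite `S ⊆ k^{1/p^∞}` and `a, d`
  algebraic over `k`, separable over `k(S)`, inside `(K₁ ⊔ k(S))^h`, with `|T − a| = |d| < |T − θ|`
  for all `θ` — PROVED (perfect base change `P = k^{1/p^∞}`, constants `C = (K₁·P)^h ∩ k̃` — perfect,
  henselian, rank one, algebraically closed in `E = (K₁·P)^h`, `E|C` immediate — exactly as in
  `valuativeInput_charP_of_henselianRational`, then the two results above, then descent of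
  henselization membership and of separability to a finite level, `HenselizationDirectedUnion.lean`,
  `ValuativeDatumFiniteLevel.lean`). No henselian rationality is used;
* `valuation_le_sub_of_forall_isAlgebraic_mem_of_charZero`, `exists_mem_valuation_sub_lt_of_split_of_charZero`,
  `exists_deep_disc_of_split_of_charZero`, `exists_deep_disc_of_charZero` — the same in residue
  characteristic `0`, where no level is needed (`S = ∅`: constants in `K₁^h ∩ k̃`; splitness by the
  trace trick, immediateness by `isImmediateOver_algebraicPart_henselization_of_charZero`) — PROVED.

Why the tree needs this (recorded for the chart series `RelativeCurveChartSetup.lean`,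
`DChartRoof.lean`): the closing reduction `Temkin2013RelativeCurveSmoothFibre.of_chartData` asks
for a chart datum whose constants `m = k(y₀)` are separable over `k` itself inside `L₁^h` and whose
conclusion (`RelCurveChart.conclusion`) takes the TRIVIAL purely inseparable extension `l = ⊥`. Such
data do not exist in general even when the generic fibre is `k`-smooth and `L₁` has a henselian
generator with no constants: for `k = 𝔽_p(u)(t)` (`t`-adic), `y = u^{1/p} + w` with
`w ∈ t²𝔽_p[[t]]` transcendental, `K = L₁ = k(y) ≤ 𝔽_p(u^{1/p})((t))`, `A ∋ y, t^{2p+1}/(y^p − u)`,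
every `k`-algebraic element of `L₁^h` lies in `k^h` (so `m°` has residue field `𝔽_p(u)`), while in
the local ring `B` of a smooth `m°`-chart containing the model one gets `y^p − u ∈ tB`, hence
`ȳ^p = u` in the function field of the smooth special fibre, which is separable over `𝔽_p(u)` —
impossible. The discs around `y` needed to make `t^{2p+1}/(y^p − u)` regular have radius
`< |t|²`, and their centres `u^{1/p} + Σ_{n<M} cₙ t^{n+2}` become available exactly at the level
`S = {u^{1/p}}`: this is the `S` of `exists_level_deep_disc`.

All statements are [folklore] consequences of the cited results; no definitions, no named facts.

## Sources

* M. Temkin, arXiv:0804.1554v3: Cor. 3.1.10, §3.2 (points of type 4), Thm. 3.2.6 (proof, Step 2),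
  Thm. 3.3.1 (proof, Step 2) (pp. 22–27 of the 41-pp. version; pp. 41–45 of v3). [Temkin2013]
* H. Knaf, F.-V. Kuhlmann, Adv. Math. 221 (2009), Lemma 2.5 (through the tree). [KnafKuhlmann2009]
-/

noncomputable section

open IsLocalRing Polynomial

namespace Literature.AlgebraicGeometry.Resolution

universe u

variable {Ω : Type u} [Field Ω] [IsAlgClosed Ω] (V : ValuationSubring Ω)

section PerfectLevel

variable (p : ℕ) [hp : Fact p.Prime] [CharP Ω p] [CharP (ResidueField V) p]

/-! ### The perfect level: a strictly closer constant -/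

/-- **A split immediate `T` has a constant STRICTLY closer than any algebraic element** (Temkin
2013, Cor. 3.1.10 + §3.2, sharpened): `C ≤ E ≤ Ω` with `C` perfect, henselian, of rank one,
`E` henselian, every element of `E` algebraic over `C` in `C`, `(E|C, V)` immediate; then for
`T ∈ E` transcendental over `C` and `θ` algebraic over `C` there is `c ∈ C` with
`|T − c| < |T − θ|`. PROVED: the tree's `forall_exists_valuation_sub_le_of_split` gives `≤` for some
`c`, and `|T − c|` can always be improved (`exists_valuation_sub_lt`, `C(T)|C` immediate).
[cite: Temkin2013, Cor. 3.1.10] [cite: KnafKuhlmann2009, Lemma 2.5] -/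
theorem exists_mem_valuation_sub_lt_of_split_of_perfect {C E : Subfield Ω} (hCE : C ≤ E)
    (hC : IsHenselianField C (V.comap (algebraMap C Ω))) (hperf : ∀ y ∈ C, ∃ b ∈ C, b ^ p = y)
    (hr1 : IsRankOneValued V C) (hE : IsHenselianField E (V.comap (algebraMap E Ω)))
    (hrel : ∀ a ∈ E, IsAlgebraic C a → a ∈ C) (himm : IsImmediateOver V C E)
    {T : Ω} (hT : T ∈ E) (hTtr : Transcendental C T) {θ : Ω} (hθ : IsAlgebraic C θ) :
    ∃ c ∈ C, V.valuation (T - c) < V.valuation (T - θ) := by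
  classical
  set CT : Subfield Ω := Subfield.closure ((C : Set Ω) ∪ {T}) with hCTdef
  have hCTE : CT ≤ E :=
    Subfield.closure_le.mpr (Set.union_subset hCE (Set.singleton_subset_iff.mpr hT))
  have himmCT : IsImmediateOver V C CT := himm.mono_right hCTE
  -- transcendence in polynomial form
  have htrans : ∀ P : Polynomial Ω, (∀ k, P.coeff k ∈ C) → P.eval T = 0 → P = 0 := by
    intro P hP hPT
    obtain ⟨P', hP'⟩ : ∃ P' : Polynomial C, P'.map (algebraMap C Ω) = P :=
      (Polynomial.mem_lifts P).mp ((Polynomial.lifts_iff_coeff_lifts P).mpr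
        fun k => ⟨⟨P.coeff k, hP k⟩, rfl⟩)
    by_contra hP0
    refine hTtr ⟨P', fun h => hP0 ?_, ?_⟩
    · rw [← hP', h, Polynomial.map_zero]
    · rw [Polynomial.aeval_def, ← Polynomial.eval_map, hP', hPT]
  have hTC : T ∉ C := not_mem_of_forall_eval_eq_zero C htrans
  have hval : ∀ w ∈ CT, w ≠ 0 → ∃ b ∈ C, V.valuation w = V.valuation b := himmCT.1
  have hres : ∀ w ∈ CT, w ∈ V → ∃ c ∈ C, V.valuation (w - c) < 1 := by
    intro w hw hwV
    have hrw : residue V ⟨w, hwV⟩ ∈ resField V C := himmCT.2 (residue_mem_resField V ⟨w, hwV⟩ hw)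
    obtain ⟨c, hcC, hcw⟩ := (mem_resField_iff V C _).mp hrw
    refine ⟨c, hcC, ?_⟩
    have h0 : residue V (⟨w, hwV⟩ - c) = 0 := by rw [map_sub, hcw, sub_self]
    exact (ValuationSubring.valuation_lt_one_iff V (⟨w, hwV⟩ - c)).mp ((residue_eq_zero_iff _).mp h0)
  -- splitness (Temkin, Cor. 3.1.10)
  have hsplit : ∀ θ g : Ω, IsAlgebraic C θ → IsAlgebraic C g →
      (∀ c ∈ C, V.valuation g ≤ V.valuation (T - c)) → V.valuation g ≤ V.valuation (T - θ) :=
    fun θ g hθ' hg hfar =>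
      valuation_le_sub_of_forall_isAlgebraic_mem_of_perfect V p hCE hC hperf hr1 hE hrel hT hθ' hg hfar
  obtain ⟨c, hcC, hc⟩ := forall_exists_valuation_sub_le_of_split V C htrans himmCT hsplit hθ
  obtain ⟨c₁, hc₁C, hc₁⟩ := exists_valuation_sub_lt V C hTC hval hres hcC
  exact ⟨c₁, hc₁C, lt_of_lt_of_le hc₁ hc⟩

/-- **Deep `C`-rational discs avoiding finitely many algebraic points**: in the setting of
`exists_mem_valuation_sub_lt_of_split_of_perfect`, for a finite set `Θ` of elements algebraic
over `C` there are a centre `a ∈ C` and a radius `d ∈ C`, `d ≠ 0`, with `|T − a| = |d| ≤ |T|` and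
`|d| < |T − θ|` for every `θ ∈ Θ` (the disc `|X − a| ≤ |d|` contains `T` and no `θ`; `a, d ∈ O_V`
whenever `T ∈ O_V`). PROVED (the best of the centre `0` and finitely many strictly closer centres;
the radius by immediateness). [cite: Temkin2013, Thm. 3.2.6 (proof, Step 2)] -/
theorem exists_deep_disc_of_split_of_perfect {C E : Subfield Ω} (hCE : C ≤ E)
    (hC : IsHenselianField C (V.comap (algebraMap C Ω))) (hperf : ∀ y ∈ C, ∃ b ∈ C, b ^ p = y)
    (hr1 : IsRankOneValued V C) (hE : IsHenselianField E (V.comap (algebraMap E Ω)))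
    (hrel : ∀ a ∈ E, IsAlgebraic C a → a ∈ C) (himm : IsImmediateOver V C E)
    {T : Ω} (hT : T ∈ E) (hTtr : Transcendental C T)
    (Θ : Finset Ω) (hΘ : ∀ θ ∈ Θ, IsAlgebraic C θ) :
    ∃ a ∈ C, ∃ d ∈ C, d ≠ 0 ∧ V.valuation (T - a) = V.valuation d ∧
      V.valuation d ≤ V.valuation T ∧ ∀ θ ∈ Θ, V.valuation d < V.valuation (T - θ) := by
  classical
  -- `T ∉ C`
  have hTC : T ∉ C := fun h => hTtr (isAlgebraic_algebraMap (⟨T, h⟩ : C))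
  -- the best of finitely many strictly-closer centres, starting from the centre `0`
  have key : ∀ Θ : Finset Ω, (∀ θ ∈ Θ, IsAlgebraic C θ) →
      ∃ a ∈ C, V.valuation (T - a) ≤ V.valuation T ∧
        ∀ θ ∈ Θ, V.valuation (T - a) < V.valuation (T - θ) := by
    intro Θ
    induction Θ using Finset.induction_on with
    | empty =>
      exact fun _ => ⟨0, C.zero_mem, by rw [sub_zero], fun θ hθ => absurd hθ (Finset.notMem_empty θ)⟩
    | @insert θ₀ s hθ₀ ih =>
      intro hs
      obtain ⟨a, haC, ha0, ha⟩ := ih fun θ hθ => hs θ (Finset.mem_insert_of_mem hθ)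
      obtain ⟨c, hcC, hc⟩ := exists_mem_valuation_sub_lt_of_split_of_perfect V p hCE hC hperf hr1
        hE hrel himm hT hTtr (hs θ₀ (Finset.mem_insert_self θ₀ s))
      rcases le_total (V.valuation (T - a)) (V.valuation (T - c)) with hle | hle
      · refine ⟨a, haC, ha0, fun θ hθ => ?_⟩
        rcases Finset.mem_insert.mp hθ with rfl | hθ
        · exact lt_of_le_of_lt hle hc
        · exact ha θ hθ
      · refine ⟨c, hcC, hle.trans ha0, fun θ hθ => ?_⟩
        rcases Finset.mem_insert.mp hθ with rfl | hθ
        · exact hc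
        · exact lt_of_le_of_lt hle (ha θ hθ)
  obtain ⟨a, haC, ha0, ha⟩ := key Θ hΘ
  have hTa0 : T - a ≠ 0 := fun h => hTC (by rw [sub_eq_zero.mp h]; exact haC)
  obtain ⟨d, hdC, hd⟩ := himm.1 (T - a) (sub_mem hT (hCE haC)) hTa0
  have hd0 : d ≠ 0 := by
    rintro rfl
    rw [map_zero, map_eq_zero] at hd
    exact hTa0 hd
  exact ⟨a, haC, d, hdC, hd0, hd, hd ▸ ha0, fun θ hθ => hd ▸ ha θ hθ⟩

end PerfectLevel

/-! ### The finite purely inseparable level -/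

set_option maxHeartbeats 1600000 in
/-- **Deep split discs at a finite purely inseparable level** (Temkin 2013, Thm. 3.2.6, proof,
Step 2, in henselizations). Let `(Ω, V)` be algebraically closed of characteristic `p > 0` with
residue characteristic `p`, `k ≤ K₁ ≤ Ω` with `k` of rank one, `|K₁^×|/|k^×|` torsion and `K̃₁|k̃`
algebraic (e.g. `K₁|k` a function field of transcendence degree one with `E = F = 0`). Let
`T ∈ K₁` be transcendental over `k` and `Θ` a finite set of elements algebraic over `k`. Then there
are a finite set `S` of purely inseparable elements over `k` and elements `a, d` algebraic over `k`,
separable over `k(S)` and lying in the henselization of `K₁ ⊔ k(S)`, with `d ≠ 0`,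
`|T − a| = |d| ≤ |T|` and `|d| < |T − θ|` for all `θ ∈ Θ`: the disc `|X − a| ≤ |d|` through `T` is
rational over separable constants of `(K₁·k(S))^h` and avoids `Θ` (and `a, d ∈ O_V` if `T ∈ O_V`). (The level `S` depends on `Θ`,
i.e. on the depth; no single finite level serves all depths.)
[cite: Temkin2013, Thm. 3.2.6 (proof, Step 2) and Cor. 3.1.10] -/
theorem exists_level_deep_disc (p : ℕ) [Fact p.Prime] [CharP Ω p] [CharP (ResidueField V) p]
    (k K₁ : Subfield Ω) (hkK₁ : k ≤ K₁) (hr1 : IsRankOneValued V k)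
    (hvt : IsValueTorsionOver V k K₁) (hra : IsResiduallyAlgebraicOver V k K₁)
    {T : Ω} (hT : T ∈ K₁) (hTtr : Transcendental k T)
    (Θ : Finset Ω) (hΘ : ∀ θ ∈ Θ, IsAlgebraic k θ) :
    ∃ (S : Finset Ω) (a d : Ω), (∀ s ∈ S, ∃ n : ℕ, s ^ (ringExpChar Ω) ^ n ∈ k) ∧
      IsAlgebraic k a ∧ IsAlgebraic k d ∧
      IsSeparable (Subfield.closure ((k : Set Ω) ∪ ↑S)) a ∧
      IsSeparable (Subfield.closure ((k : Set Ω) ∪ ↑S)) d ∧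
      a ∈ henselization V (K₁ ⊔ Subfield.closure ((k : Set Ω) ∪ ↑S)) ∧
      d ∈ henselization V (K₁ ⊔ Subfield.closure ((k : Set Ω) ∪ ↑S)) ∧
      d ≠ 0 ∧ V.valuation (T - a) = V.valuation d ∧ V.valuation d ≤ V.valuation T ∧
      ∀ θ ∈ Θ, V.valuation d < V.valuation (T - θ) := by
  classical
  have hp' : p.Prime := Fact.out
  have hH := Kuhlmann2010HenselizationIsHenselian_holds.{u}
  ------------------------------------------------------------------
  -- ### Step 1: the perfect hull `P` of `k`, `K' = K₁·P`
  ------------------------------------------------------------------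
  set P : Subfield Ω := perfectHull k with hPdef
  have hkP : k ≤ P := le_perfectHull k
  have hPalg : ∀ s ∈ P, IsAlgebraic k s := fun s hs => isAlgebraic_of_mem_perfectHull k hs
  haveI : PerfectField P := perfectField_perfectHull k
  set K' : Subfield Ω := K₁ ⊔ P with hK'def
  have hK₁K' : K₁ ≤ K' := le_sup_left
  have hPK' : P ≤ K' := le_sup_right
  have hkK' : k ≤ K' := hkP.trans hPK'
  have hK'alg : ∀ w ∈ K', IsAlgebraic K₁ w := by
    intro w hw
    have hw' : w ∈ Subfield.closure ((K₁ : Set Ω) ∪ (P : Set Ω)) := by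
      rwa [Subfield.closure_union, Subfield.closure_eq, Subfield.closure_eq]
    exact isAlgebraic_of_mem_closure (fun s hs => isAlgebraic_of_subfield_le hkK₁ (hPalg s hs)) hw'
  ------------------------------------------------------------------
  -- ### Step 2: `E = K'^h`, the constants `C = E ∩ k̃`
  ------------------------------------------------------------------
  set E : Subfield Ω := henselization V K' with hEdef
  set C : Subfield Ω := E ⊓ (algebraicClosure k Ω).toSubfield with hCdef
  have hK'E : K' ≤ E := le_henselization V K'
  have hE : IsHenselianField E (V.comap (algebraMap E Ω)) := hH Ω V K'
  have himmK'E : IsImmediateOver V K' E := Kuhlmann2010HenselizationImmediate_holds Ω V K'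
  have hCE : C ≤ E := inf_le_left
  have hCalg : ∀ w ∈ C, IsAlgebraic k w := fun w hw =>
    mem_algebraicClosure_iff.mp (Subfield.mem_inf.mp hw).2
  have hmemC : ∀ {w : Ω}, w ∈ E → IsAlgebraic k w → w ∈ C := fun hwE hw =>
    Subfield.mem_inf.mpr ⟨hwE, mem_algebraicClosure_iff.mpr hw⟩
  have hPC : P ≤ C := fun s hs => hmemC (hK'E (hPK' hs)) (hPalg s hs)
  have hkC : k ≤ C := hkP.trans hPC
  have hCrelE : ∀ a ∈ E, IsAlgebraic C a → a ∈ C := fun a haE ha =>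
    hmemC haE (isAlgebraic_trans_subfield hkC hCalg ha)
  -- `C` is henselian
  have hChens : IsHenselianField C (V.comap (algebraMap C Ω)) := by
    have hle : henselization V C ≤ C := by
      intro w hw
      refine hCrelE w (henselization_le_of_isHenselianField V C hCE hE hw) ?_
      exact (isSeparable_of_mem_henselization V C hw).isIntegral.isAlgebraic
    exact IsHenselianField.of_subfield_algebraic V hle
      (fun y hy => isAlgebraic_algebraMap (⟨y, le_henselization V C hy⟩ : henselization V C))
      (hH Ω V C)
  -- `C` is perfect
  have hCperf : ∀ y ∈ C, ∃ b ∈ C, b ^ p = y := by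
    intro y hy
    obtain ⟨b, hb⟩ := IsAlgClosed.exists_pow_nat_eq y hp'.pos
    have hyP : IsAlgebraic P y := isAlgebraic_of_subfield_le hkP (hCalg y hy)
    have hbalgP : IsAlgebraic P b := IsAlgebraic.of_pow hp'.pos (hb ▸ hyP)
    have hsepb : IsSeparable (Subfield.closure ((P : Set Ω) ∪ {y})) b :=
      isSeparable_of_subfield_le (fun s hs => Subfield.subset_closure (Or.inl hs))
        (isSeparable_of_isAlgebraic_of_perfectField hbalgP)
    haveI : ExpChar Ω p := ExpChar.prime hp'
    have hq : ringExpChar Ω = p := ringExpChar.eq Ω p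
    have hbPy : b ∈ Subfield.closure ((P : Set Ω) ∪ {y}) := by
      refine mem_of_isSeparable_of_pow_ringExpChar_pow_mem _ hsepb (n := 1) ?_
      rw [hq, pow_one, hb]
      exact Subfield.subset_closure (Or.inr rfl)
    have hbE : b ∈ E :=
      (Subfield.closure_le.mpr (Set.union_subset (hPK'.trans hK'E)
        (Set.singleton_subset_iff.mpr (hCE hy)))) hbPy
    refine ⟨b, hmemC hbE ?_, hb⟩
    exact IsAlgebraic.of_pow hp'.pos (hb ▸ hCalg y hy)
  haveI : PerfectField C := perfectField_of_forall_exists_pow_eq p hCperf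
  -- `C` has rank one
  have hCr1 : IsRankOneValued V C := IsRankOneValued.of_algebraic V hkC hr1 hCalg
  -- `E|C` is immediate (Temkin, Thm. 3.2.3, Step 2)
  have hvtK' : IsValueTorsionOver V k K' :=
    hvt.trans (isValueTorsionOver_of_isAlgebraic V hK'alg)
  have hraK' : IsResiduallyAlgebraicOver V k K' :=
    hra.trans hkK₁ (isResiduallyAlgebraicOver_of_isAlgebraic V hK'alg)
  have himmE : IsImmediateOver V C E := by
    refine isImmediateOver_of_forall_isAlgebraic_mem V p hCE hCperf hE hCrelE ?_ ?_
    · intro a haE ha0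
      obtain ⟨b, hbK', hab⟩ := himmK'E.1 a haE ha0
      have hb0 : b ≠ 0 := by
        rintro rfl
        rw [map_zero, map_eq_zero] at hab
        exact ha0 hab
      obtain ⟨n, hn0, c, hck, hbc⟩ := hvtK' b hbK' hb0
      refine ⟨n, hn0, c, hkC hck, ?_⟩
      rw [map_pow, hab, ← map_pow, hbc]
    · intro r hrE hrV
      have h1 : residue V ⟨r, hrV⟩ ∈ resField V K' :=
        himmK'E.2 (residue_mem_resField V ⟨r, hrV⟩ hrE)
      exact isAlgebraic_of_subfield_le (resField_mono V hkC) (hraK' _ h1)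
  ------------------------------------------------------------------
  -- ### Step 3: the deep disc over `C`
  ------------------------------------------------------------------
  have hTE : T ∈ E := hK'E (hK₁K' hT)
  have hTC : Transcendental C T := fun h => hTtr (isAlgebraic_trans_subfield hkC hCalg h)
  have hΘC : ∀ θ ∈ Θ, IsAlgebraic C θ := fun θ hθ => isAlgebraic_of_subfield_le hkC (hΘ θ hθ)
  obtain ⟨a, haC, d, hdC, hd0, hTad, hdT, hdeep⟩ :=
    exists_deep_disc_of_split_of_perfect V p hCE hChens hCperf hCr1 hE hCrelE himmE hTE hTC Θ hΘC
  ------------------------------------------------------------------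
  -- ### Step 4: descent to a finite level
  ------------------------------------------------------------------
  -- (4a) henselization membership: `a, d ∈ (k ∪ S₂ ∪ K₁)^h`
  have hCh : C ≤ henselization V (K₁ ⊔ P) := hCE
  obtain ⟨S₂, hS₂P, hS₂⟩ := exists_finset_forall_mem_henselization_closure_levels V hkP
    (K₁ : Set Ω) ({a, d} : Finset Ω) (fun y hy => by
      have hyC : y ∈ C := by
        rcases Finset.mem_insert.mp hy with rfl | hy
        · exact haC
        · rw [Finset.mem_singleton.mp hy]; exact hdC
      have h1 : y ∈ henselization V (K₁ ⊔ P) := hCh hyC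
      have h2 : K₁ ⊔ P ≤ Subfield.closure ((P : Set Ω) ∪ (K₁ : Set Ω)) :=
        sup_le (fun x hx => Subfield.subset_closure (Or.inr hx))
          (fun x hx => Subfield.subset_closure (Or.inl hx))
      exact henselization_mono V hH h2 h1)
  -- (4b) separability over `k(S₄)`: the coefficients of the minimal polynomials over `P`
  have hCsep : ∀ c ∈ C, IsSeparable P c := fun c hc =>
    isSeparable_of_isAlgebraic_of_perfectField (isAlgebraic_of_subfield_le hkP (hCalg c hc))
  set Y : Finset Ω := ({a, d} : Finset Ω) with hYdef
  have hYC : ∀ y ∈ Y, y ∈ C := by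
    intro y hy
    rcases Finset.mem_insert.mp hy with rfl | hy
    · exact haC
    · rw [Finset.mem_singleton.mp hy]; exact hdC
  set Tc : Finset Ω := Y.biUnion fun y => ((minpoly P y).support.image fun i =>
    ((minpoly P y).coeff i : Ω)) with hTcdef
  have hTcP : ∀ z ∈ Tc, z ∈ Subfield.closure ((P : Set Ω) ∪ ∅) := by
    intro z hz
    obtain ⟨y, -, hz⟩ := Finset.mem_biUnion.mp hz
    obtain ⟨i, -, rfl⟩ := Finset.mem_image.mp hz
    rw [Set.union_empty]
    exact Subfield.subset_closure ((minpoly P y).coeff i).2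
  obtain ⟨S₄, hS₄P, hS₄⟩ := exists_finset_forall_mem_closure_levels hkP (∅ : Set Ω) Tc hTcP
  ------------------------------------------------------------------
  -- ### the common level `S = S₂ ∪ S₄`
  ------------------------------------------------------------------
  set S : Finset Ω := S₂ ∪ S₄ with hSdef
  have hScoe : (↑S : Set Ω) = ↑S₂ ∪ ↑S₄ := by rw [hSdef, Finset.coe_union]
  have hSP : (↑S : Set Ω) ⊆ P := by rw [hScoe]; exact Set.union_subset hS₂P hS₄P
  have h2S : (↑S₂ : Set Ω) ⊆ ↑S := by rw [hScoe]; exact Set.subset_union_left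
  have h4S : (↑S₄ : Set Ω) ⊆ ↑S := by rw [hScoe]; exact Set.subset_union_right
  -- separability over `k(S)`
  have hsepS : ∀ y ∈ Y, IsSeparable (Subfield.closure ((k : Set Ω) ∪ ↑S)) y := by
    intro y hy
    have hkS₄ : Subfield.closure ((k : Set Ω) ∪ ↑S₄ ∪ ∅) ≤ Subfield.closure ((k : Set Ω) ∪ ↑S) := by
      rw [Set.union_empty]
      exact Subfield.closure_mono (Set.union_subset_union_right _ h4S)
    have hkSP : Subfield.closure ((k : Set Ω) ∪ ↑S) ≤ P :=
      Subfield.closure_le.mpr (Set.union_subset hkP hSP)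
    refine isSeparable_of_forall_coeff_mem hkSP (hCsep y (hYC y hy)) fun i => ?_
    by_cases hi : i ∈ (minpoly P y).support
    · exact hkS₄ (hS₄ _ (Finset.mem_biUnion.mpr ⟨y, hy, Finset.mem_image.mpr ⟨i, hi, rfl⟩⟩))
    · rw [Polynomial.notMem_support_iff.mp hi]
      exact Subfield.zero_mem _
  -- henselization membership over `K₁ ⊔ k(S)`
  have hhS : ∀ y ∈ Y, y ∈ henselization V (K₁ ⊔ Subfield.closure ((k : Set Ω) ∪ ↑S)) := by
    intro y hy
    have hle : Subfield.closure ((k : Set Ω) ∪ ↑S₂ ∪ (K₁ : Set Ω)) ≤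
        K₁ ⊔ Subfield.closure ((k : Set Ω) ∪ ↑S) := by
      refine Subfield.closure_le.mpr ?_
      rintro x ((hx | hx) | hx)
      · exact (le_sup_right : _ ≤ K₁ ⊔ _) (Subfield.subset_closure (Or.inl hx))
      · exact (le_sup_right : _ ≤ K₁ ⊔ _) (Subfield.subset_closure (Or.inr (h2S hx)))
      · exact (le_sup_left : K₁ ≤ K₁ ⊔ _) hx
    exact henselization_mono V hH hle (hS₂ y hy)
  have haY : a ∈ Y := Finset.mem_insert_self a {d}
  have hdY : d ∈ Y := Finset.mem_insert_of_mem (Finset.mem_singleton_self d)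
  haveI : ExpChar Ω p := ExpChar.prime hp'
  have hq : ringExpChar Ω = p := ringExpChar.eq Ω p
  refine ⟨S, a, d, fun s hs => ?_, hCalg a haC, hCalg d hdC, hsepS a haY, hsepS d hdY,
    hhS a haY, hhS d hdY, hd0, hTad, hdT, hdeep⟩
  -- `S ⊆ P`: purely inseparable over `k`
  obtain ⟨n, hn⟩ := (mem_perfectHull_iff' k).mp (hSP hs)
  exact ⟨n, hn⟩


/-! ### Residue characteristic `0`: the same, with `S = ∅` (no perfectness, no rank condition) -/

section CharZero

variable [CharZero (ResidueField V)]

/-- **Splitness in residue characteristic `0`** (the tame twin of Temkin's Cor. 3.1.10): for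
subfields `C ≤ E ≤ Ω` with `E` henselian and every element of `E` algebraic over `C` in `C`, and
`T ∈ E`: if `g` (any element) has `|g| ≤ |T − c|` for all `c ∈ C`, then `|g| ≤ |T − θ|` for
every `θ` algebraic over `C`. PROVED: otherwise `|g| ≤ |θ − c|` for all `c`, the trace trick
(`exists_aroots_valuation_le_of_valuation_natDegree_eq_one`; `|deg θ| = 1` in residue
characteristic `0`) gives a conjugate `θ'` with `|g| ≤ |θ − θ'|`, hence `|θ' − T| > |θ − T|`, while
conjugation over the henselian `E ∋ T` preserves `|· − T|`. [folklore] -/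
theorem valuation_le_sub_of_forall_isAlgebraic_mem_of_charZero {C E : Subfield Ω} (hCE : C ≤ E)
    (hE : IsHenselianField E (V.comap (algebraMap E Ω)))
    (hrel : ∀ a ∈ E, IsAlgebraic C a → a ∈ C) {T : Ω} (hT : T ∈ E) {θ : Ω}
    (hθ : IsAlgebraic C θ) {g : Ω} (hg : ∀ c ∈ C, V.valuation g ≤ V.valuation (T - c)) :
    V.valuation g ≤ V.valuation (T - θ) := by
  classical
  by_contra hlt
  push Not at hlt
  -- `|θ - c| = |T - c| ≥ |g|` for `c ∈ C`
  have hθc : ∀ c ∈ C, V.valuation g ≤ V.valuation (θ - c) := by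
    intro c hc
    have h1 : V.valuation (T - θ) < V.valuation (T - c) := lt_of_lt_of_le hlt (hg c hc)
    have hid : θ - c = (T - c) - (T - θ) := by ring
    rw [hid, Valuation.map_sub_eq_of_lt_left _ h1]
    exact hg c hc
  -- trace trick: a conjugate `θ'` of `θ` over `C` with `|g| ≤ |θ - θ'|`
  have hint : IsIntegral C θ := hθ.isIntegral
  have hn : V.valuation ((minpoly C θ).natDegree : Ω) = 1 :=
    valuation_natCast_eq_one_of_residue_ne_zero V
      (Nat.cast_ne_zero.mpr (minpoly.natDegree_pos hint).ne')
  obtain ⟨θ', hθ', hgθ'⟩ :=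
    exists_aroots_valuation_le_of_valuation_natDegree_eq_one V hint hn hθc
  have hfar : V.valuation (T - θ) < V.valuation (θ - θ') := lt_of_lt_of_le hlt hgθ'
  have hne : V.valuation (θ' - T) ≠ V.valuation (θ - T) := by
    have hid : θ' - T = -((θ - θ') + (T - θ)) := by ring
    rw [hid, Valuation.map_neg, Valuation.map_add_eq_of_lt_left _ hfar, Valuation.map_sub_swap V.valuation θ T]
    exact (ne_of_lt hfar).symm
  -- but `θ'` is an `E`-conjugate of `θ`, and conjugation over the henselian `E` preserves `|· - T|`
  have hθ'E : θ' ∈ (minpoly E θ).aroots Ω :=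
    mem_aroots_minpoly_of_forall_isAlgebraic_mem hCE hrel hint hθ'
  have hθE : IsAlgebraic E θ := isAlgebraic_of_subfield_le hCE hθ
  have hconj : IsConjRoot E θ θ' := (isConjRoot_iff_mem_minpoly_aroots hθE.isIntegral).mpr hθ'E
  have key := hE.valuation_aeval_eq_of_isConjRoot_of_subfield V hθE hconj
    (X - Polynomial.C (⟨T, hT⟩ : E))
  have h1 : aeval θ (X - Polynomial.C (⟨T, hT⟩ : E)) = θ - T := by simp; rfl
  have h2 : aeval θ' (X - Polynomial.C (⟨T, hT⟩ : E)) = θ' - T := by simp; rfl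
  rw [h1, h2] at key
  exact hne key.symm

/-- **A strictly closer constant, residue characteristic `0`**: `C ≤ E ≤ Ω`, `E` henselian,
`C` algebraically closed in `E`, `(E|C, V)` immediate, `T ∈ E` transcendental over `C`, `θ`
algebraic over `C` ⇒ `|T − c| < |T − θ|` for some `c ∈ C`. PROVED as in characteristic `p`.
[folklore] -/
theorem exists_mem_valuation_sub_lt_of_split_of_charZero {C E : Subfield Ω} (hCE : C ≤ E)
    (hE : IsHenselianField E (V.comap (algebraMap E Ω)))
    (hrel : ∀ a ∈ E, IsAlgebraic C a → a ∈ C) (himm : IsImmediateOver V C E)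
    {T : Ω} (hT : T ∈ E) (hTtr : Transcendental C T) {θ : Ω} (hθ : IsAlgebraic C θ) :
    ∃ c ∈ C, V.valuation (T - c) < V.valuation (T - θ) := by
  classical
  set CT : Subfield Ω := Subfield.closure ((C : Set Ω) ∪ {T}) with hCTdef
  have hCTE : CT ≤ E :=
    Subfield.closure_le.mpr (Set.union_subset hCE (Set.singleton_subset_iff.mpr hT))
  have himmCT : IsImmediateOver V C CT := himm.mono_right hCTE
  have htrans : ∀ P : Polynomial Ω, (∀ k, P.coeff k ∈ C) → P.eval T = 0 → P = 0 := by
    intro P hP hPT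
    obtain ⟨P', hP'⟩ : ∃ P' : Polynomial C, P'.map (algebraMap C Ω) = P :=
      (Polynomial.mem_lifts P).mp ((Polynomial.lifts_iff_coeff_lifts P).mpr
        fun k => ⟨⟨P.coeff k, hP k⟩, rfl⟩)
    by_contra hP0
    refine hTtr ⟨P', fun h => hP0 ?_, ?_⟩
    · rw [← hP', h, Polynomial.map_zero]
    · rw [Polynomial.aeval_def, ← Polynomial.eval_map, hP', hPT]
  have hTC : T ∉ C := not_mem_of_forall_eval_eq_zero C htrans
  have hval : ∀ w ∈ CT, w ≠ 0 → ∃ b ∈ C, V.valuation w = V.valuation b := himmCT.1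
  have hres : ∀ w ∈ CT, w ∈ V → ∃ c ∈ C, V.valuation (w - c) < 1 := by
    intro w hw hwV
    have hrw : residue V ⟨w, hwV⟩ ∈ resField V C := himmCT.2 (residue_mem_resField V ⟨w, hwV⟩ hw)
    obtain ⟨c, hcC, hcw⟩ := (mem_resField_iff V C _).mp hrw
    refine ⟨c, hcC, ?_⟩
    have h0 : residue V (⟨w, hwV⟩ - c) = 0 := by rw [map_sub, hcw, sub_self]
    exact (ValuationSubring.valuation_lt_one_iff V (⟨w, hwV⟩ - c)).mp ((residue_eq_zero_iff _).mp h0)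
  have hsplit : ∀ θ g : Ω, IsAlgebraic C θ → IsAlgebraic C g →
      (∀ c ∈ C, V.valuation g ≤ V.valuation (T - c)) → V.valuation g ≤ V.valuation (T - θ) :=
    fun θ g hθ' _ hfar =>
      valuation_le_sub_of_forall_isAlgebraic_mem_of_charZero V hCE hE hrel hT hθ' hfar
  obtain ⟨c, hcC, hc⟩ := forall_exists_valuation_sub_le_of_split V C htrans himmCT hsplit hθ
  obtain ⟨c₁, hc₁C, hc₁⟩ := exists_valuation_sub_lt V C hTC hval hres hcC
  exact ⟨c₁, hc₁C, lt_of_lt_of_le hc₁ hc⟩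

/-- **Deep `C`-rational discs, residue characteristic `0`**: as `exists_deep_disc_of_split_of_perfect`.
[folklore] -/
theorem exists_deep_disc_of_split_of_charZero {C E : Subfield Ω} (hCE : C ≤ E)
    (hE : IsHenselianField E (V.comap (algebraMap E Ω)))
    (hrel : ∀ a ∈ E, IsAlgebraic C a → a ∈ C) (himm : IsImmediateOver V C E)
    {T : Ω} (hT : T ∈ E) (hTtr : Transcendental C T)
    (Θ : Finset Ω) (hΘ : ∀ θ ∈ Θ, IsAlgebraic C θ) :
    ∃ a ∈ C, ∃ d ∈ C, d ≠ 0 ∧ V.valuation (T - a) = V.valuation d ∧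
      V.valuation d ≤ V.valuation T ∧ ∀ θ ∈ Θ, V.valuation d < V.valuation (T - θ) := by
  classical
  have hTC : T ∉ C := fun h => hTtr (isAlgebraic_algebraMap (⟨T, h⟩ : C))
  have key : ∀ Θ : Finset Ω, (∀ θ ∈ Θ, IsAlgebraic C θ) →
      ∃ a ∈ C, V.valuation (T - a) ≤ V.valuation T ∧
        ∀ θ ∈ Θ, V.valuation (T - a) < V.valuation (T - θ) := by
    intro Θ
    induction Θ using Finset.induction_on with
    | empty =>
      exact fun _ => ⟨0, C.zero_mem, by rw [sub_zero], fun θ hθ => absurd hθ (Finset.notMem_empty θ)⟩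
    | @insert θ₀ s hθ₀ ih =>
      intro hs
      obtain ⟨a, haC, ha0, ha⟩ := ih fun θ hθ => hs θ (Finset.mem_insert_of_mem hθ)
      obtain ⟨c, hcC, hc⟩ := exists_mem_valuation_sub_lt_of_split_of_charZero V hCE hE hrel himm
        hT hTtr (hs θ₀ (Finset.mem_insert_self θ₀ s))
      rcases le_total (V.valuation (T - a)) (V.valuation (T - c)) with hle | hle
      · refine ⟨a, haC, ha0, fun θ hθ => ?_⟩
        rcases Finset.mem_insert.mp hθ with rfl | hθ
        · exact lt_of_le_of_lt hle hc
        · exact ha θ hθ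
      · refine ⟨c, hcC, hle.trans ha0, fun θ hθ => ?_⟩
        rcases Finset.mem_insert.mp hθ with rfl | hθ
        · exact hc
        · exact lt_of_le_of_lt hle (ha θ hθ)
  obtain ⟨a, haC, ha0, ha⟩ := key Θ hΘ
  have hTa0 : T - a ≠ 0 := fun h => hTC (by rw [sub_eq_zero.mp h]; exact haC)
  obtain ⟨d, hdC, hd⟩ := himm.1 (T - a) (sub_mem hT (hCE haC)) hTa0
  have hd0 : d ≠ 0 := by
    rintro rfl
    rw [map_zero, map_eq_zero] at hd
    exact hTa0 hd
  exact ⟨a, haC, d, hdC, hd0, hd, hd ▸ ha0, fun θ hθ => hd ▸ ha θ hθ⟩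

/-- **Deep split discs in residue characteristic `0`** (no level needed): for `k ≤ K₁ ≤ (Ω, V)`
of residue characteristic `0` with `|K₁^×|/|k^×|` torsion and `K̃₁|k̃` algebraic, `T ∈ K₁`
transcendental over `k` and finitely many `θ` algebraic over `k`, there are `a, d ∈ K₁^h` algebraic
over `k` with `d ≠ 0`, `|T − a| = |d| ≤ |T|` and `|d| < |T − θ|` for all `θ` (constants
`C = K₁^h ∩ k̃`, over which `K₁^h` is immediate: `isImmediateOver_algebraicPart_henselization_of_charZero`).
[cite: Temkin2013, Thm. 3.3.1 (proof, Step 2), Remark 3.2.7] [folklore] -/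
theorem exists_deep_disc_of_charZero (k K₁ : Subfield Ω) (hkK₁ : k ≤ K₁)
    (hvt : IsValueTorsionOver V k K₁) (hra : IsResiduallyAlgebraicOver V k K₁)
    {T : Ω} (hT : T ∈ K₁) (hTtr : Transcendental k T)
    (Θ : Finset Ω) (hΘ : ∀ θ ∈ Θ, IsAlgebraic k θ) :
    ∃ a d : Ω, IsAlgebraic k a ∧ IsAlgebraic k d ∧
      a ∈ henselization V K₁ ∧ d ∈ henselization V K₁ ∧
      d ≠ 0 ∧ V.valuation (T - a) = V.valuation d ∧ V.valuation d ≤ V.valuation T ∧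
      ∀ θ ∈ Θ, V.valuation d < V.valuation (T - θ) := by
  classical
  set E : Subfield Ω := henselization V K₁ with hEdef
  set C : Subfield Ω := E ⊓ (algebraicClosure k Ω).toSubfield with hCdef
  have hE : IsHenselianField E (V.comap (algebraMap E Ω)) :=
    Kuhlmann2010HenselizationIsHenselian_holds Ω V K₁
  have hK₁E : K₁ ≤ E := le_henselization V K₁
  have hCE : C ≤ E := inf_le_left
  have hkC : k ≤ C := fun c hc =>
    Subfield.mem_inf.mpr ⟨hK₁E (hkK₁ hc),
      mem_algebraicClosure_iff.mpr (isAlgebraic_algebraMap (⟨c, hc⟩ : k))⟩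
  have hCalg : ∀ w ∈ C, IsAlgebraic k w := fun w hw =>
    mem_algebraicClosure_iff.mp (Subfield.mem_inf.mp hw).2
  have hrel : ∀ a ∈ E, IsAlgebraic C a → a ∈ C := fun a haE ha =>
    Subfield.mem_inf.mpr ⟨haE, mem_algebraicClosure_iff.mpr (isAlgebraic_trans_subfield hkC hCalg ha)⟩
  have himm : IsImmediateOver V C E :=
    isImmediateOver_algebraicPart_henselization_of_charZero V hkK₁ hvt hra
  have hTE : T ∈ E := hK₁E hT
  have hTC : Transcendental C T := fun h => hTtr (isAlgebraic_trans_subfield hkC hCalg h)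
  have hΘC : ∀ θ ∈ Θ, IsAlgebraic C θ := fun θ hθ => isAlgebraic_of_subfield_le hkC (hΘ θ hθ)
  obtain ⟨a, haC, d, hdC, hd0, hTad, hdT, hdeep⟩ :=
    exists_deep_disc_of_split_of_charZero V hCE hE hrel himm hTE hTC Θ hΘC
  exact ⟨a, d, hCalg a haC, hCalg d hdC, hCE haC, hCE hdC, hd0, hTad, hdT, hdeep⟩

end CharZero

end Literature.AlgebraicGeometry.Resolution

end
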